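import Summits.Ventures.YMGap.Census.TwistCensusObjects
import HarnessLib

/-!
# Venture YMGap, track (b) census — reflection geometry of a RECTANGULAR torus `L₀ × L₁ × ⋯ × L_{d−1}` across the
# hyperplanes between time slices (`x₀ = ½` and `x₀ = (L₀ + 1)/2`), `L₀` even: sites, links, plaquettes — DEFINITIONS + lemmas

HONEST FRAMING: venture file of the cell `pub-ymgap` (QuantumFields programme), track (b).  Pure finite combinatorics of the
rectangular torus `RectTorusSite Ls = Π_i ℤ/(Ls i)` (`Literature/MathematicalPhysics/QuantumLattice/LatticeTori.lean`) with the
links / plaquettes of `Census/TwistCensusObjects.lean`; no integral, no physics.  It is the VERBATIM PORT to a general side vector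
`Ls : Fin d → ℕ` of the tree's cubic reflection geometry `Literature.MathematicalPhysics.QuantumFieldTheory.WilsonRP`
(`ConstructiveQFTWave0Proofs`, §§ Sites / Val / Classification, written for `Site d L = Fin d → ZMod L`), time axis `0`, time
extent `L₀ := Ls 0` (the only side whose parity matters); every proof is the cubic proof with `L ↦ Ls 0`.  Purpose: the
Osterwalder–Seiler reflection positivity SIGN RULE for the one-character Haar moments of the census on rectangular tori
(`Census/TwistCensusTopMomentRectRP.lean`), extending the even-CUBE sign rule of `Census/TwistCensusTopMomentRP.lean` to the
tori `2²×L`, `2×3×L`, `2×4×L`, `4²×L`, … of the census rows of record.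

* `siteReflect x = (1 − x₀, x⃗)` (`Function.update x 0 (1 - x 0)`), shifts `x + Pi.single i 1`; involution and commutation
  lemmas; time arithmetic (`ZMod.val`) of shifted / reflected sites;
* classification: `IsPosLink` (both endpoints in `Λ₊ = {1 ≤ x₀ ≤ L₀/2}`), `IsCrossLink` / `IsLowerLink` / `IsUpperLink`,
  `IsCrossPlaquette`, `IsPosPlaquette`, `IsNegPlaquette`; `linkReflect`, `plaquetteReflect` (involutions);
  `isNegPlaquette_plaquetteReflect_iff` (the mirror exchanges positive and negative plaquettes), `not_isPosLink_linkReflect`.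
References: K. Osterwalder, E. Seiler, Ann. Phys. 110 (1978) 440, §2 [cite: OsterwalderSeilerAnnPhys1978, §2]; E. Seiler,
LNP 159 (1982) Ch. 2 [folklore].
-/

namespace Summit.Ventures.YMGap.Census

open Literature.MathematicalPhysics.QuantumLattice

namespace RectRP

variable {d : ℕ} {Ls : Fin d → ℕ}

/-! ### Sites: shifts and the time reflection -/

section Sites

/-- Shifting in direction `i` does not change the other coordinates. -/
theorem shift_apply_of_ne (x : RectTorusSite Ls) {i k : Fin d} (h : k ≠ i) :
    (x + Pi.single i 1 : RectTorusSite Ls) k = x k := by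
  simp [Pi.single_eq_of_ne h]

/-- Shifting in direction `i` adds one to the `i`-th coordinate. -/
@[simp] theorem shift_apply_self (x : RectTorusSite Ls) (i : Fin d) :
    (x + Pi.single i 1 : RectTorusSite Ls) i = x i + 1 := by
  simp

/-- Shifts commute. -/
theorem shift_comm (x : RectTorusSite Ls) (i j : Fin d) :
    (x + Pi.single i 1 + Pi.single j 1 : RectTorusSite Ls) = x + Pi.single j 1 + Pi.single i 1 := by
  rw [add_assoc, add_assoc, add_comm (Pi.single i 1)]

variable [NeZero d]

/-- **Time reflection of sites** in the hyperplane between the slices `x₀ = 0 | 1` (and `x₀ = L₀/2 | L₀/2 + 1`):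
`θ(t, x⃗) = (1 − t, x⃗)`, time being coordinate `0` (the cubic `Site.timeReflect` verbatim). -/
def siteReflect (x : RectTorusSite Ls) : RectTorusSite Ls :=
  Function.update x 0 (1 - x 0)

/-- The time coordinate of the reflected site. -/
@[simp] theorem siteReflect_apply_zero (x : RectTorusSite Ls) : siteReflect x 0 = 1 - x 0 := by
  simp [siteReflect]

/-- The reflection does not change the spatial coordinates. -/
theorem siteReflect_apply_of_ne (x : RectTorusSite Ls) {k : Fin d} (h : k ≠ 0) : siteReflect x k = x k := by
  simp [siteReflect, h]

/-- The time reflection of sites is an involution. -/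
@[simp] theorem siteReflect_siteReflect (x : RectTorusSite Ls) : siteReflect (siteReflect x) = x := by
  funext k
  by_cases hk : k = 0
  · subst hk; simp
  · simp [siteReflect_apply_of_ne _ hk]

/-- Reflection commutes with spatial shifts. -/
theorem siteReflect_shift_of_ne (x : RectTorusSite Ls) {i : Fin d} (hi : i ≠ 0) :
    siteReflect (x + Pi.single i 1) = siteReflect x + Pi.single i 1 := by
  funext k
  by_cases hk : k = 0
  · subst hk
    rw [siteReflect_apply_zero, shift_apply_of_ne _ (Ne.symm hi), shift_apply_of_ne _ (Ne.symm hi),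
      siteReflect_apply_zero]
  · rw [siteReflect_apply_of_ne _ hk]
    by_cases hki : k = i
    · subst hki
      rw [shift_apply_self, shift_apply_self, siteReflect_apply_of_ne _ hk]
    · rw [shift_apply_of_ne _ hki, shift_apply_of_ne _ hki, siteReflect_apply_of_ne _ hk]

/-- `θ(θ(x + e₀) + e₀) = x`: the reflection of temporal links is an involution. -/
@[simp] theorem siteReflect_shift_siteReflect_shift (x : RectTorusSite Ls) :
    siteReflect (siteReflect (x + Pi.single 0 1) + Pi.single 0 1) = x := by
  funext k
  by_cases hk : k = 0
  · subst hk
    simp only [siteReflect_apply_zero, shift_apply_self]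
    ring
  · rw [siteReflect_apply_of_ne _ hk, shift_apply_of_ne _ hk, siteReflect_apply_of_ne _ hk, shift_apply_of_ne _ hk]

/-- `θ(x + e₀) + e₀ = θ x`. -/
theorem siteReflect_shift_shift (x : RectTorusSite Ls) :
    siteReflect (x + Pi.single 0 1) + Pi.single 0 1 = siteReflect x := by
  funext k
  by_cases hk : k = 0
  · subst hk
    simp only [siteReflect_apply_zero, shift_apply_self]
    ring
  · rw [shift_apply_of_ne _ hk, siteReflect_apply_of_ne _ hk, siteReflect_apply_of_ne _ hk, shift_apply_of_ne _ hk]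

/-- `θ(x + eⱼ + e₀) = θ(x + e₀) + eⱼ` for a spatial direction `j`. -/
theorem siteReflect_shift_shift_zero (x : RectTorusSite Ls) {j : Fin d} (hj : j ≠ 0) :
    siteReflect (x + Pi.single j 1 + Pi.single 0 1) = siteReflect (x + Pi.single 0 1) + Pi.single j 1 := by
  rw [shift_comm, siteReflect_shift_of_ne _ hj]

/-- On the two reflection hyperplanes (`2t = 0`): `θ(x + e₀) = x`. -/
theorem siteReflect_shift_of_two_mul {x : RectTorusSite Ls} (h : x 0 + x 0 = 0) :
    siteReflect (x + Pi.single 0 1) = x := by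
  funext k
  by_cases hk : k = 0
  · subst hk
    simp only [siteReflect_apply_zero, shift_apply_self]
    linear_combination -h
  · rw [siteReflect_apply_of_ne _ hk, shift_apply_of_ne _ hk]

/-- On the two reflection hyperplanes (`2t = 0`): `θ x = x + e₀`. -/
theorem siteReflect_of_two_mul {x : RectTorusSite Ls} (h : x 0 + x 0 = 0) :
    siteReflect x = x + Pi.single 0 1 := by
  funext k
  by_cases hk : k = 0
  · subst hk
    simp only [siteReflect_apply_zero, shift_apply_self]
    linear_combination -h
  · rw [siteReflect_apply_of_ne _ hk, shift_apply_of_ne _ hk]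

end Sites

/-! ### Time arithmetic (`ZMod.val`), `L₀ := Ls 0` -/

section Val

variable [NeZero d] [∀ i, NeZero (Ls i)] [Fact (1 < Ls 0)]

omit [NeZero d] [∀ i, NeZero (Ls i)] [Fact (1 < Ls 0)] in
/-- Shifts in other directions do not change a coordinate. -/
theorem val_shift_of_ne (x : RectTorusSite Ls) {i k : Fin d} (h : k ≠ i) :
    ((x + Pi.single i 1 : RectTorusSite Ls) k).val = (x k).val := by
  rw [shift_apply_of_ne _ h]

omit [NeZero d] [Fact (1 < Ls 0)] in
/-- The `k`-coordinate of `x + e_k` (every side `≥ 1`; for `Ls k = 1` both sides are `0`). -/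
theorem val_shift_self (x : RectTorusSite Ls) (k : Fin d) :
    ((x + Pi.single k 1 : RectTorusSite Ls) k).val = if (x k).val + 1 = Ls k then 0 else (x k).val + 1 := by
  rw [shift_apply_self, ZMod.val_add, ZMod.val_one_eq_one_mod]
  have hlt := ZMod.val_lt (x k)
  by_cases h1 : Ls k = 1
  · have h0 : (x k).val = 0 := by omega
    rw [h0, h1]
    decide
  · rw [Nat.mod_eq_of_lt (show 1 < Ls k by have := NeZero.ne (Ls k); omega)]
    split_ifs with h
    · rw [h, Nat.mod_self]
    · exact Nat.mod_eq_of_lt (by omega)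

/-- Time coordinate of `θ x`. -/
theorem val_siteReflect (x : RectTorusSite Ls) :
    (siteReflect x 0).val =
      if (x 0).val = 0 then 1 else if (x 0).val = 1 then 0 else Ls 0 + 1 - (x 0).val := by
  rw [siteReflect_apply_zero, sub_eq_add_neg, ZMod.val_add, ZMod.val_one, ZMod.neg_val]
  have hlt := ZMod.val_lt (x 0)
  have h1L : 1 < Ls 0 := Fact.out
  by_cases h0 : x 0 = 0
  · have hv : (x 0).val = 0 := by rw [h0, ZMod.val_zero]
    rw [if_pos h0, if_pos hv, add_zero]
    exact Nat.mod_eq_of_lt h1L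
  · have hv : (x 0).val ≠ 0 := fun h => h0 ((ZMod.val_eq_zero _).1 h)
    rw [if_neg h0, if_neg hv]
    by_cases h1 : (x 0).val = 1
    · rw [if_pos h1, h1, show 1 + (Ls 0 - 1) = Ls 0 by omega, Nat.mod_self]
    · rw [if_neg h1, Nat.mod_eq_of_lt (by omega)]
      omega

omit [Fact (1 < Ls 0)] in
/-- Time coordinate of `θ(x + e₀)` (it is `−t`). -/
theorem val_siteReflect_shift_zero (x : RectTorusSite Ls) :
    (siteReflect (x + Pi.single 0 1) 0).val = if (x 0).val = 0 then 0 else Ls 0 - (x 0).val := by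
  rw [siteReflect_apply_zero, shift_apply_self, show (1 : ZMod (Ls 0)) - (x 0 + 1) = -x 0 by ring, ZMod.neg_val]
  by_cases h0 : x 0 = 0
  · have hv : (x 0).val = 0 := by rw [h0, ZMod.val_zero]
    rw [if_pos h0, if_pos hv]
  · have hv : (x 0).val ≠ 0 := fun h => h0 ((ZMod.val_eq_zero _).1 h)
    rw [if_neg h0, if_neg hv]

omit [Fact (1 < Ls 0)] in
/-- The two reflection hyperplanes: `t = 0` or `t = L₀/2` forces `2t = 0` (`L₀` even). -/
theorem two_mul_eq_zero_of_val (hL : Even (Ls 0)) {x : RectTorusSite Ls}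
    (h : (x 0).val = 0 ∨ (x 0).val = Ls 0 / 2) : x 0 + x 0 = 0 := by
  rcases h with h | h
  · rw [(ZMod.val_eq_zero _).1 h, add_zero]
  · rw [← ZMod.natCast_zmod_val (x 0), h, ← Nat.cast_add,
      show Ls 0 / 2 + Ls 0 / 2 = Ls 0 by obtain ⟨r, hr⟩ := hL; omega, ZMod.natCast_self]

end Val

/-! ### Classification of links and plaquettes -/

section Classification

variable [NeZero d]

/-- Positive-time links: both endpoints in `Λ₊ = {1 ≤ t ≤ L₀/2}`. -/
def IsPosLink (e : RectEdge Ls) : Prop :=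
  1 ≤ (e.1 0).val ∧ (e.1 0).val ≤ Ls 0 / 2 ∧ 1 ≤ ((e.1 + Pi.single e.2 1 : RectTorusSite Ls) 0).val ∧
    ((e.1 + Pi.single e.2 1 : RectTorusSite Ls) 0).val ≤ Ls 0 / 2

/-- Crossing links: temporal links from `t = 0` to `t = 1` or from `t = L₀/2` to `t = L₀/2 + 1`. -/
def IsCrossLink (e : RectEdge Ls) : Prop := e.2 = 0 ∧ ((e.1 0).val = 0 ∨ (e.1 0).val = Ls 0 / 2)

/-- Lower crossing links (`t = 0 → 1`); their variables are split as `U · Y`. -/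
def IsLowerLink (e : RectEdge Ls) : Prop := e.2 = 0 ∧ (e.1 0).val = 0

/-- Upper crossing links (`t = L₀/2 → L₀/2 + 1`); their variables are split as `Y · U`. -/
def IsUpperLink (e : RectEdge Ls) : Prop := e.2 = 0 ∧ (e.1 0).val = Ls 0 / 2

/-- `IsPosLink` is decidable. -/
instance : DecidablePred (IsPosLink (Ls := Ls)) := fun _ => by unfold IsPosLink; infer_instance
/-- `IsCrossLink` is decidable. -/
instance : DecidablePred (IsCrossLink (Ls := Ls)) := fun _ => by unfold IsCrossLink; infer_instance
/-- `IsLowerLink` is decidable. -/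
instance : DecidablePred (IsLowerLink (Ls := Ls)) := fun _ => by unfold IsLowerLink; infer_instance
/-- `IsUpperLink` is decidable. -/
instance : DecidablePred (IsUpperLink (Ls := Ls)) := fun _ => by unfold IsUpperLink; infer_instance

/-- Crossing plaquettes: temporal plaquettes based at `t = 0` or `t = L₀/2`. -/
def IsCrossPlaquette (p : RectPlaquette Ls) : Prop :=
  p.2.1.1 = 0 ∧ ((p.1 0).val = 0 ∨ (p.1 0).val = Ls 0 / 2)

/-- Positive plaquettes: all four links are positive-time links. -/
def IsPosPlaquette (p : RectPlaquette Ls) : Prop :=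
  1 ≤ (p.1 0).val ∧ (if p.2.1.1 = 0 then (p.1 0).val + 1 ≤ Ls 0 / 2 else (p.1 0).val ≤ Ls 0 / 2)

/-- Negative plaquettes: the remaining ones (all four links in `θΛ₊`). -/
def IsNegPlaquette (p : RectPlaquette Ls) : Prop := ¬ IsPosPlaquette p ∧ ¬ IsCrossPlaquette p

/-- `IsCrossPlaquette` is decidable. -/
instance : DecidablePred (IsCrossPlaquette (Ls := Ls)) := fun _ => by unfold IsCrossPlaquette; infer_instance
/-- `IsPosPlaquette` is decidable. -/
instance : DecidablePred (IsPosPlaquette (Ls := Ls)) := fun _ => by unfold IsPosPlaquette; infer_instance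
/-- `IsNegPlaquette` is decidable. -/
instance : DecidablePred (IsNegPlaquette (Ls := Ls)) := fun _ => by unfold IsNegPlaquette; infer_instance

/-- The reflection on (positively oriented) links: `(x, i) ↦ (θx, i)` for spatial `i`, and the temporal link
`x → x + e₀` goes to the temporal link `θ(x + e₀) → θx`. -/
def linkReflect (e : RectEdge Ls) : RectEdge Ls :=
  if e.2 = 0 then (siteReflect (e.1 + Pi.single 0 1), 0) else (siteReflect e.1, e.2)

/-- The reflection on plaquettes (same rule on the base point, plane unchanged). -/
def plaquetteReflect (p : RectPlaquette Ls) : RectPlaquette Ls :=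
  (if p.2.1.1 = 0 then siteReflect (p.1 + Pi.single 0 1) else siteReflect p.1, p.2)

/-- `linkReflect` is an involution. -/
theorem linkReflect_linkReflect (e : RectEdge Ls) : linkReflect (linkReflect e) = e := by
  obtain ⟨x, i⟩ := e
  unfold linkReflect
  by_cases hi : i = 0
  · subst hi; simp
  · simp [hi]

/-- `plaquetteReflect` is an involution. -/
theorem plaquetteReflect_plaquetteReflect (p : RectPlaquette Ls) : plaquetteReflect (plaquetteReflect p) = p := by
  obtain ⟨x, ij⟩ := p
  unfold plaquetteReflect
  by_cases hi : ij.1.1 = 0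
  · simp [hi]
  · simp [hi]

/-- `linkReflect` as a permutation of the links. -/
def linkReflectEquiv : Equiv.Perm (RectEdge Ls) :=
  Function.Involutive.toPerm linkReflect linkReflect_linkReflect

/-- `plaquetteReflect` as a permutation of the plaquettes. -/
def plaquetteReflectEquiv : Equiv.Perm (RectPlaquette Ls) :=
  Function.Involutive.toPerm plaquetteReflect plaquetteReflect_plaquetteReflect

/-- The mirror keeps the plane of a plaquette. -/
@[simp] theorem plaquetteReflect_snd (p : RectPlaquette Ls) : (plaquetteReflect p).2 = p.2 := rfl

/-- The mirror keeps the spatial coordinates of the base point of a plaquette. -/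
theorem plaquetteReflect_fst_apply_of_ne (p : RectPlaquette Ls) {k : Fin d} (hk : k ≠ 0) :
    (plaquetteReflect p).1 k = p.1 k := by
  unfold plaquetteReflect
  split_ifs
  · show siteReflect (p.1 + Pi.single 0 1) k = p.1 k
    rw [siteReflect_apply_of_ne _ hk, shift_apply_of_ne _ hk]
  · show siteReflect p.1 k = p.1 k
    rw [siteReflect_apply_of_ne _ hk]

variable [∀ i, NeZero (Ls i)] [Fact (1 < Ls 0)]

omit [Fact (1 < Ls 0)] in
/-- Positive links in terms of the time coordinate of the base point. -/
theorem isPosLink_iff (e : RectEdge Ls) :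
    IsPosLink e ↔ 1 ≤ (e.1 0).val ∧
      (if e.2 = 0 then (e.1 0).val + 1 ≤ Ls 0 / 2 else (e.1 0).val ≤ Ls 0 / 2) := by
  obtain ⟨x, i⟩ := e
  have hlt := ZMod.val_lt (x 0)
  simp only [IsPosLink]
  by_cases hi : i = 0
  · subst hi
    rw [if_pos rfl, val_shift_self]
    split_ifs with h <;> omega
  · rw [if_neg hi, shift_apply_of_ne x (Ne.symm hi)]
    omega

/-- Crossing links are not positive. -/
theorem not_isPosLink_of_isCrossLink (hL : Even (Ls 0)) {e : RectEdge Ls} (he : IsCrossLink e) : ¬ IsPosLink e := by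
  rw [isPosLink_iff e]
  obtain ⟨h0, ht⟩ := he
  rw [if_pos h0]
  have hE := Nat.even_iff.mp hL
  have h1L : 1 < Ls 0 := Fact.out
  omega

/-- The reflection of a positive or crossing link is not positive (it lies in `θΛ₊` or is crossing). -/
theorem not_isPosLink_linkReflect (hL : Even (Ls 0)) {e : RectEdge Ls} (he : IsPosLink e ∨ IsCrossLink e) :
    ¬ IsPosLink (linkReflect e) := by
  obtain ⟨x, i⟩ := e
  have hlt := ZMod.val_lt (x 0)
  have h1L : 1 < Ls 0 := Fact.out
  have hE := Nat.even_iff.mp hL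
  rw [isPosLink_iff (x, i)] at he
  rw [isPosLink_iff (linkReflect (x, i))]
  simp only [IsCrossLink] at he
  unfold linkReflect
  by_cases hi : i = 0
  · subst hi
    simp only [↓reduceIte] at he ⊢
    rw [val_siteReflect_shift_zero]
    split_ifs <;> omega
  · simp only [hi, ↓reduceIte, false_and, or_false] at he ⊢
    rw [val_siteReflect]
    split_ifs <;> omega

/-- The reflection of a positive link is not crossing. -/
theorem not_isCrossLink_linkReflect (hL : Even (Ls 0)) {e : RectEdge Ls} (he : IsPosLink e) :
    ¬ IsCrossLink (linkReflect e) := by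
  obtain ⟨x, i⟩ := e
  have hlt := ZMod.val_lt (x 0)
  have h1L : 1 < Ls 0 := Fact.out
  have hE := Nat.even_iff.mp hL
  rw [isPosLink_iff (x, i)] at he
  unfold linkReflect IsCrossLink
  by_cases hi : i = 0
  · subst hi
    simp only [↓reduceIte] at he ⊢
    rw [val_siteReflect_shift_zero]
    split_ifs <;> omega
  · simp only [hi, ↓reduceIte] at he ⊢
    simp

omit [∀ i, NeZero (Ls i)] in
/-- Crossing plaquettes are not positive. -/
theorem not_isPosPlaquette_of_isCrossPlaquette (hL : Even (Ls 0)) {p : RectPlaquette Ls} (hp : IsCrossPlaquette p) :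
    ¬ IsPosPlaquette p := by
  obtain ⟨h0, ht⟩ := hp
  unfold IsPosPlaquette
  rw [if_pos h0]
  have hE := Nat.even_iff.mp hL
  have h1L : 1 < Ls 0 := Fact.out
  omega

/-- The reflection exchanges positive and negative plaquettes. -/
theorem isNegPlaquette_plaquetteReflect_iff (hL : Even (Ls 0)) (p : RectPlaquette Ls) :
    IsNegPlaquette (plaquetteReflect p) ↔ IsPosPlaquette p := by
  obtain ⟨x, ij⟩ := p
  have hlt := ZMod.val_lt (x 0)
  have h1L : 1 < Ls 0 := Fact.out
  have hE := Nat.even_iff.mp hL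
  unfold IsNegPlaquette IsPosPlaquette IsCrossPlaquette plaquetteReflect
  by_cases hi : ij.1.1 = 0
  · simp only [hi, ↓reduceIte, true_and]
    rw [val_siteReflect_shift_zero]
    split_ifs <;> omega
  · simp only [hi, ↓reduceIte, false_and, not_false_eq_true, and_true]
    rw [val_siteReflect]
    split_ifs <;> omega

end Classification

end RectRP

end Summit.Ventures.YMGap.Census
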